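/-
Copyright (c) 2026 the pub-hodgecm-mathlib formalisation cell (harness21).  Prover seat hodgecm-mathlib-K2E4-p10 (g8), Track B «K2-LIT»,
#184♮ = hLiu418 = `stmt-HodgeConjecture-24832`; socket #41, KIND W, this seat's share `(w hw0 hws hg)` of F0P2-p08 (g0)'s
`K2LiuSiegelEisensteinWhittakerFactorLetters.exists_whittaker_factorLetters` (LEAD F0P6-plan (g14) BATCH #52, desk K2E5-p17 (g8) 2026-09-04T16:17:21Z).
THEOREMS ONLY (no `def`, no `instance`, no notation, no named-fact hypothesis, no `sorry`).
-/
import Summits.HodgeConjecture.HodgeConjecture.Theorems.K2LiuWhittakerWeightedGrowthOfDecay      -- ★ p861906 (this seat): `weightedGrowth_of_decay_and_support`, `summable_weight_of_latticeCount`, `weight_nonneg`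
import Summits.HodgeConjecture.HodgeConjecture.Theorems.K2LiuLatticeFibreCount                  -- ★ p861947 (this seat): `latticeFibreCount`, `tsum_one_add_norm_pow_inv_nonneg`
import Summits.HodgeConjecture.HodgeConjecture.Theorems.K2LiuSiegelEisensteinWhittakerMajorant   -- ★ p861512 (this seat): the frame (`HA`, `skewMatrices`, `gramR`, `adelicHeightGL`)
import Summits.HodgeConjecture.HodgeConjecture.Theorems.K2LiuGoodPlaceWhittakerProductBound      -- ★ `norm_inv_b_le_uniform_cm` (`‖(b^U(s))⁻¹‖ ≤ C(σ₀)` uniformly in `U`); brings `partialStandardL`, `quadraticHeckeCharCM`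
import Mathlib.NumberTheory.NumberField.CanonicalEmbedding.Basic
import Mathlib.RingTheory.Algebraic.Integral
import Mathlib.RingTheory.Localization.Integral
import HarnessLib

/-!
# Crux `HLiu418`, socket #41, KIND W — `K2LiuWhittakerWeightedGrowthInstance`: THE SUMMABLE LATTICE WEIGHT `(w, hw0, hws, hg)` OF THE TOP AT THE WHITTAKER DATA `WT·GW`

Cell `hodgecm-mathlib`, crux item hLiu418 = `stmt-HodgeConjecture-24832` (helper lane `--supports … --as helper`, count-neutral), route of record `HCCMUnconditional`;
squad K2 ∕ K2Liu, road `K2_Liu`, socket #41, KIND W.  CONSUMER: F0P2-p08 (g0)'s `K2LiuSiegelEisensteinWhittakerFactorLetters.exists_whittaker_factorLetters`, whose by-value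
letters `(w) (hw0 : ∀ S, 0 ≤ w S) (hws : Summable w) (hg : …‖A S s h * (b^{U S h}(s))⁻¹‖ ≤ C * w S * ‖h‖^{A'}…)` are conjuncts 3–5 of the TOP's KIND-W package (★ ed. 9 ∕ 10).

THE MATHEMATICS ([MoeglinWaldspurger1995, I.2.2, II.1.7, IV.1.9]; [Shimura1997, §18.4, Prop. 18.14]; [KudlaRallis1994, §1]; [BorelJacquet1979, §1.2]).  The Fourier index of the TOP
runs over the full `L⁺`-space of `T`-skew (= skew-hermitian) matrices `S ∈ M_n(L)` — dense archimedeanly — so an `h`-independent summable weight must decay in the SIZE and in the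
DENOMINATOR of `S`: `w(S) = (1 + τ(S))^{−k} · d(S)^{−(k+2)}` with `τ(S) ≥` the sup-norm of the archimedean (mixed) embedding of the entries of `S`, `d(S)` the least `D ≥ 1` with
`D·S ∈ M_n(𝓞_L)`, and `k = rk_ℤ M_n(𝓞_L) + 1`.  Summability (`hws`): the fibre `{d = D}` injects into the `ℤ`-lattice `M_n(𝓞_L) ⊂ M_n(L ⊗ ℝ)` by `S ↦ D·S` with norms `≤ D·τ(S)`, so
`Σ_{d(S)=D}(1+τ)^{−k} ≤ C(Λ₀)·D^k` (★ p861947) and `Σ_D C·D^{k}·D^{−(k+2)} < ∞` (★ p861906).  Growth (`hg`): the archimedean Whittaker function decays like `e^{−c·λ·τ(S)}` with the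
Iwasawa eigenvalue `λ ≥ ‖h‖^{−A′}` (letter (L-dec), rows G4 × G7), the Whittaker coefficient vanishes unless `S` lies in the dual lattice of the level of `h`, whose denominators are
`≤ C₀‖h‖^κ` (letter (L-supp), row G3 × finite height), and `e^{−aτ}(1+τ)^N ≤ (e^{a}(N+k)!∕a^{N+k})(1+τ)^{−k}` (★ p861878) trades the decay for the weight (★ p861906) — with the
uniform bound `‖(b^U(s))⁻¹‖ ≤ C(σ₀)` (★ `norm_inv_b_le_uniform_cm`) and the HEIGHT FLOOR `‖g‖ ≥ 1∕n` on `GL_n(𝔸)` (§1: `1 = (g_∞ g_∞⁻¹)_{ii}` ⇒ `n·H_∞(g)² ≥ 1`).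
* §1 `exists_pos_le_adelicHeightGL` — the floor `∃ m > 0, ∀ g, m ≤ ‖g‖` (`n ≥ 1`).
* §2 `exists_den` — every `S ∈ M_n(L)` has a denominator `D ≥ 1` (`D·S_{ij}` integral over `ℤ`); `mixed_mem_span` — integral matrices embed into the `ℤ`-span of the Pi-basis of
  Mathlib's `latticeBasis L` (a discrete `ℤ`-lattice of `M_n(L ⊗_ℚ ℝ)`).
* §3 **`exists_whittaker_weight`** — GENERIC: for `WT GW : Skew → ℂ → H(𝔸) → ℂ`, from (L-dec) on `WT`, a locally uniform moderate-growth bound on `GW`, and (L-supp) on the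
  product: `∃ w, (∀ S, 0 ≤ w S) ∧ Summable w ∧ «hg for WT·GW»`.
* §4 **`exists_whittaker_factorLetters_weight`** — AT F0P2-p08's BYTES: `WT := A`, `GW S s h := (b^{U S h}(s))⁻¹`; letters (L-dec), (L-supp) on `A` alone; output = conjuncts
  `hw0 ∧ hws ∧ hg` of `exists_whittaker_factorLetters` verbatim.
HONEST LABEL.  Count-neutral helper, hypothesis-first on the two analytic letters (L-dec), (L-supp) of rows G3∕G4∕G7; `HC_CM` is proved only modulo the 7 printed citations
(2 remaining named inputs: hLiu418 = `stmt-HodgeConjecture-24832`, h413 = `stmt-HodgeConjecture-24833`) until rung 0 closes; this file closes no socket.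

## References
* [MoeglinWaldspurger1995] C. Mœglin, J.-L. Waldspurger, *Spectral decomposition and Eisenstein series*, Cambridge Tracts 113 (1995), I.2.2, II.1.7, IV.1.9.
* [Shimura1997] G. Shimura, *Euler products and Eisenstein series*, CBMS 93 (1997), §18.4, Prop. 18.14.
* [KudlaRallis1994] S. Kudla, S. Rallis, Ann. of Math. 140 (1994), §1.
* [BorelJacquet1979] A. Borel, H. Jacquet, *Automorphic forms and automorphic representations*, Proc. Sympos. Pure Math. 33.1 (1979), §1.2.
-/

set_option autoImplicit false
set_option linter.dupNamespace false -- the mandated namespace repeats `HodgeConjecture.HodgeConjecture`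

noncomputable section

namespace Summit.HodgeConjecture.HodgeConjecture.Cruxes.HLiu418.K2LiuWhittakerWeightedGrowthInstance

open scoped Matrix NNReal BigOperators Classical
open NumberField NumberField.mixedEmbedding IsDedekindDomain Metric
open Literature.NumberTheory.Automorphic

/-! ## §1 The height floor on `GL_n(𝔸_K)` -/

section Floor

variable {n : ℕ} {K : Type} [Field K] [NumberField K]

/-- `‖1‖ ≥ 1` in the mixed space `K ⊗_ℚ ℝ = ℝ^{r₁} × ℂ^{r₂}` (sup norm; there is an infinite place). [folklore] -/
theorem one_le_norm_one_mixedSpace : (1 : ℝ) ≤ ‖(1 : mixedSpace K)‖ := by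
  obtain ⟨w⟩ := (inferInstance : Nonempty (InfinitePlace K))
  rw [← map_one (mixedEmbedding K), norm_eq_sup'_normAtPlace]
  refine le_trans ?_ (Finset.le_sup' (fun w => normAtPlace w (mixedEmbedding K 1)) (Finset.mem_univ w))
  show 1 ≤ normAtPlace w (mixedEmbedding K 1)
  rw [normAtPlace_apply, map_one]

/-- **`1 ≤ n · H_∞(g)²`**: `1 = (g_∞ g_∞⁻¹)_{ii}` is a sum of `n` products of entries of `g_∞` and `g_∞⁻¹`. Borel–Jacquet 1979, §1.2 (property (i)).
[cite: BorelJacquet1979, §1.2] -/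
theorem one_le_card_mul_archHeight_sq [NeZero n] (g : GL (Fin n) (AdeleRing (𝓞 K) K)) :
    (1 : ℝ) ≤ n * (GLn.archHeight n K g * GLn.archHeight n K g) := by
  set G := GLn.toMixed n K g with hG
  let i : Fin n := ⟨0, Nat.pos_of_ne_zero (NeZero.ne n)⟩
  have h := nnnorm_mul_apply_le (nnnorm_apply_le_sup G) (nnnorm_inv_apply_le_sup G) i i
  have hone : ((G : Matrix (Fin n) (Fin n) (mixedSpace K)) * ((G⁻¹ : GL (Fin n) (mixedSpace K)) : Matrix (Fin n) (Fin n) (mixedSpace K))) i i = 1 := by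
    rw [← Units.val_mul, mul_inv_cancel, Units.val_one, Matrix.one_apply_eq]
  rw [hone, Fintype.card_fin] at h
  have h' : ((‖(1 : mixedSpace K)‖₊ : ℝ≥0) : ℝ) ≤ n * (GLn.archHeight n K g * GLn.archHeight n K g) := by
    unfold GLn.archHeight
    exact_mod_cast h
  rw [coe_nnnorm] at h'
  exact one_le_norm_one_mixedSpace.trans h'

/-- **THE HEIGHT FLOOR**: `‖g‖ ≥ 1∕n` for every `g ∈ GL_n(𝔸_K)` (`n ≥ 1`): `H_∞(g) ≥ 1∕n` by `one_le_card_mul_archHeight_sq` and `∏_v H_v(g) ≥ 1`. Borel–Jacquet 1979, §1.2 (i).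
[cite: BorelJacquet1979, §1.2] [cite: MoeglinWaldspurger1995, I.2.2] -/
theorem exists_pos_le_adelicHeightGL [NeZero n] :
    ∃ m : ℝ, 0 < m ∧ ∀ g : GL (Fin n) (AdeleRing (𝓞 K) K), m ≤ adelicHeightGL n K g := by
  have hn : (0 : ℝ) < n := by exact_mod_cast Nat.pos_of_ne_zero (NeZero.ne n)
  have hn1 : (1 : ℝ) ≤ n := by exact_mod_cast Nat.one_le_iff_ne_zero.2 (NeZero.ne n)
  refine ⟨(n : ℝ)⁻¹, inv_pos.2 hn, fun g => ?_⟩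
  have h1 := one_le_card_mul_archHeight_sq (K := K) g
  set A : ℝ := (GLn.archHeight n K g : ℝ) with hA
  have hA0 : 0 ≤ A := NNReal.coe_nonneg _
  have hAn : (n : ℝ)⁻¹ ≤ A := by
    rw [inv_le_iff_one_le_mul₀' hn]
    rcases le_or_gt 1 A with hA1 | hA1
    · exact hA1.trans (le_mul_of_one_le_left hA0 hn1)
    · exact h1.trans (mul_le_mul_of_nonneg_left (mul_le_of_le_one_left hA0 hA1.le) hn.le)
  calc (n : ℝ)⁻¹ ≤ A := hAn
    _ ≤ A * ∏ᶠ v, (GLn.localHeight n K v g : ℝ) := le_mul_of_one_le_right hA0 (GLn.one_le_finprod_localHeight g)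
    _ = adelicHeightGL n K g := rfl

end Floor

/-! ## §2 Denominators and the integral lattice `M_n(𝓞_L) ⊂ M_n(L ⊗_ℚ ℝ)` -/

section Den

variable (L : Type) [Field L] [NumberField L] {n : ℕ}

/-- **every `S ∈ M_n(L)` has a denominator**: `∃ D ≥ 1` with `D·S_{ij}` integral over `ℤ` for all `i j` (`L∕ℚ` is algebraic; clear the denominators of the `n²` entries at once).
[cite: NeukirchANT1999, Ch. I §2] -/
theorem exists_den (S : Matrix (Fin n) (Fin n) L) : ∃ D : ℕ, 1 ≤ D ∧ ∀ i j, IsIntegral ℤ ((D : L) * S i j) := by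
  classical
  haveI : Algebra.IsAlgebraic ℤ L := (IsFractionRing.comap_isAlgebraic_iff (A := ℤ) (K := ℚ) (C := L)).mpr inferInstance
  obtain ⟨y, hy, hint⟩ := Algebra.IsAlgebraic.exists_integral_multiples ℤ (Finset.univ.image fun ij : Fin n × Fin n => S ij.1 ij.2)
  refine ⟨y.natAbs, Int.natAbs_pos.2 hy, fun i j => ?_⟩
  have hij := hint (S i j) (Finset.mem_image.2 ⟨(i, j), Finset.mem_univ _, rfl⟩)
  rw [Algebra.smul_def, algebraMap_int_eq, Int.coe_castRingHom] at hij
  have hcast : ((y.natAbs : ℕ) : L) = ((y.natAbs : ℤ) : L) := (Int.cast_natCast _).symm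
  rcases Int.natAbs_eq y with h | h
  · rw [hcast, ← h]; exact hij
  · have h' : (y.natAbs : ℤ) = -y := by omega
    rw [hcast, h', Int.cast_neg, neg_mul]; exact hij.neg

/-- **integral matrices embed into the `ℤ`-lattice** spanned by the Pi-basis of Mathlib's `latticeBasis L` in `M_n(L ⊗_ℚ ℝ) = (Fin n → Fin n → mixedSpace L)`: if every
`S_{ij}` is integral over `ℤ` then `(σ(S_{ij}))_{ij,σ}` has integer coordinates. [cite: NeukirchANT1999, Ch. I §5] -/
theorem mixed_mem_span {S : Matrix (Fin n) (Fin n) L} (hS : ∀ i j, IsIntegral ℤ (S i j)) :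
    (fun i j => mixedEmbedding L (S i j)) ∈
      Submodule.span ℤ (Set.range (Pi.basis fun _ : Fin n => Pi.basis fun _ : Fin n => latticeBasis L)) := by
  refine ((Pi.basis fun _ : Fin n => Pi.basis fun _ : Fin n => latticeBasis L).mem_span_iff_repr_mem ℤ _).2 ?_
  rintro ⟨i, j, l⟩
  simp only [Pi.basis_repr]
  have hij : mixedEmbedding L (S i j) ∈ Submodule.span ℤ (Set.range (latticeBasis L)) := by
    rw [mem_span_latticeBasis]
    exact ⟨⟨S i j, hS i j⟩, rfl⟩
  exact ((latticeBasis L).mem_span_iff_repr_mem ℤ _).1 hij l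

omit [NumberField L] in
/-- scalar bookkeeping: `(D : ℝ) • σ(x) = σ(D·x)` in the mixed space. [folklore] -/
theorem natCast_smul_mixedEmbedding (D : ℕ) (x : L) : (D : ℝ) • mixedEmbedding L x = mixedEmbedding L ((D : L) * x) := by
  rw [map_mul, map_natCast, Algebra.smul_def, map_natCast]

end Den

/-! ## §3 The summable lattice weight at generic Whittaker data `WT · GW` -/

section Generic

open Literature.NumberTheory.GelbartRogawski1991 Literature.NumberTheory.GelbartRogawski1991.GRConstruction
open Literature.NumberTheory.K2Lit.SiegelDoubled
open K2LiuSiegelUnipotentFourierDefs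
open K2LiuWhittakerWeightedGrowthOfDecay (weightedGrowth_of_decay_and_support summable_weight_of_latticeCount weight_nonneg)
open K2LiuLatticeFibreCount (latticeFibreCount tsum_one_add_norm_pow_inv_nonneg)

variable (L : Type) [Field L] [NumberField L] [IsCMField L] {N M n : ℕ} (hn : 0 < n) (e : Fin N × Fin M ≃ Fin n)
  (dV : Fin N → L) (hdV : ∀ i, IsCMField.complexConj L (dV i) = dV i)
  (dW : Fin M → L) (hdW : ∀ i, IsCMField.complexConj L (dW i) = dW i)

include hn in
/-- **THE SUMMABLE LATTICE WEIGHT AT GENERIC WHITTAKER DATA.**  `WT GW : Skew → ℂ → H(𝔸) → ℂ` on the TOP's Fourier index `Skew = skewMatrices c (gramR ⊗ L)`; `τ(S) ≥` the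
sup-norm of the mixed embedding of the entries of `S`.  LETTERS BY VALUE: (L-dec) `‖WT S s h‖ ≤ C·‖h‖^A·e^{−c‖h‖^{−A′}τ(S)}(1+τ(S))^{N₀}` near every `z` with `0 < re z`; a locally
uniform moderate-growth bound `‖GW S s h‖ ≤ C·‖h‖^A`; (L-supp) on `{0 < re s}`: `WT·GW ≠ 0 ⇒` a denominator `D ≤ C₀‖h‖^κ` of `S`.  OUTPUT: a weight `w ≥ 0`, SUMMABLE, with
`‖WT S s h · GW S s h‖ ≤ C(z)·w(S)·‖h‖^A` near every `z` — the TOP's `(w, hw0, hws, hg)` (`w(S) = (1+τ S)^{−k}·d(S)^{−(k+2)}`, `k = rk M_n(𝓞_L) + 1`, `d` the least denominator).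
[cite: MoeglinWaldspurger1995, II.1.7, IV.1.9] [cite: Shimura1997, §18.4, Prop. 18.14] [cite: KudlaRallis1994, §1] [cite: BorelJacquet1979, §1.2] -/
theorem exists_whittaker_weight
    (WT GW : skewMatrices ((IsCMField.complexConj L : L ≃ₐ[Fp L] L) : L →+* L) ((gramR L e dV hdV dW hdW).map (algebraMap (Fp L) L)) → ℂ → HA L e dV hdV dW hdW → ℂ)
    (τ : skewMatrices ((IsCMField.complexConj L : L ≃ₐ[Fp L] L) : L →+* L) ((gramR L e dV hdV dW hdW).map (algebraMap (Fp L) L)) → ℝ)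
    (hτ : ∀ S : skewMatrices ((IsCMField.complexConj L : L ≃ₐ[Fp L] L) : L →+* L) ((gramR L e dV hdV dW hdW).map (algebraMap (Fp L) L)),
      ‖(fun i j => mixedEmbedding L ((S : Matrix (Fin n) (Fin n) L) i j))‖ ≤ τ S) (N₀ : ℕ)
    (hdec : ∀ z : ℂ, 0 < z.re → ∃ C A c A' r : ℝ, 0 ≤ C ∧ 0 ≤ A ∧ 0 < c ∧ 0 ≤ A' ∧ 0 < r ∧ ∀ S (s : ℂ), dist s z < r → ∀ h : HA L e dV hdV dW hdW,
      ‖WT S s h‖ ≤ C * adelicHeightGL (n + n) L (h : GL (Fin (n + n)) (AdeleRing (𝓞 L) L)) ^ A *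
        (Real.exp (-(c * adelicHeightGL (n + n) L (h : GL (Fin (n + n)) (AdeleRing (𝓞 L) L)) ^ (-A') * τ S)) * (1 + τ S) ^ N₀))
    (hbdd : ∀ z : ℂ, 0 < z.re → ∃ C A r : ℝ, 0 ≤ C ∧ 0 ≤ A ∧ 0 < r ∧ ∀ S (s : ℂ), dist s z < r → ∀ h : HA L e dV hdV dW hdW,
      ‖GW S s h‖ ≤ C * adelicHeightGL (n + n) L (h : GL (Fin (n + n)) (AdeleRing (𝓞 L) L)) ^ A)
    {C₀ κ : ℝ} (hC₀ : 0 < C₀) (hκ : 0 ≤ κ)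
    (hsupp : ∀ S (s : ℂ) (h : HA L e dV hdV dW hdW), 0 < s.re → WT S s h * GW S s h ≠ 0 →
      ∃ D : ℕ, 1 ≤ D ∧ (D : ℝ) ≤ C₀ * adelicHeightGL (n + n) L (h : GL (Fin (n + n)) (AdeleRing (𝓞 L) L)) ^ κ ∧
        ∀ i j, IsIntegral ℤ ((D : L) * (S : Matrix (Fin n) (Fin n) L) i j)) :
    ∃ w : skewMatrices ((IsCMField.complexConj L : L ≃ₐ[Fp L] L) : L →+* L) ((gramR L e dV hdV dW hdW).map (algebraMap (Fp L) L)) → ℝ,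
      (∀ S, 0 ≤ w S) ∧ (Summable w) ∧
      (∀ z : ℂ, 0 < z.re → ∃ C A r : ℝ, 0 ≤ C ∧ 0 ≤ A ∧ 0 < r ∧ ∀ S (s : ℂ), dist s z < r → ∀ h : HA L e dV hdV dW hdW,
        ‖WT S s h * GW S s h‖ ≤ C * w S * adelicHeightGL (n + n) L (h : GL (Fin (n + n)) (AdeleRing (𝓞 L) L)) ^ A) := by
  classical
  haveI : NeZero (n + n) := ⟨by omega⟩
  -- the height floor
  obtain ⟨m, hm, hfloor'⟩ := exists_pos_le_adelicHeightGL (n := n + n) (K := L)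
  have hfloor : ∀ h : HA L e dV hdV dW hdW, m ≤ adelicHeightGL (n + n) L (h : GL (Fin (n + n)) (AdeleRing (𝓞 L) L)) := fun h => hfloor' _
  have hHpos : ∀ h : HA L e dV hdV dW hdW, 0 < adelicHeightGL (n + n) L (h : GL (Fin (n + n)) (AdeleRing (𝓞 L) L)) := fun h => hm.trans_le (hfloor h)
  have hτ0 : ∀ S, 0 ≤ τ S := fun S => (norm_nonneg _).trans (hτ S)
  -- the least denominator
  let d : skewMatrices ((IsCMField.complexConj L : L ≃ₐ[Fp L] L) : L →+* L) ((gramR L e dV hdV dW hdW).map (algebraMap (Fp L) L)) → ℕ :=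
    fun S => Nat.find (exists_den L (S : Matrix (Fin n) (Fin n) L))
  have hd_spec : ∀ S, 1 ≤ d S ∧ ∀ i j, IsIntegral ℤ ((d S : L) * (S : Matrix (Fin n) (Fin n) L) i j) :=
    fun S => Nat.find_spec (exists_den L (S : Matrix (Fin n) (Fin n) L))
  have hd_min : ∀ S (D : ℕ), 1 ≤ D → (∀ i j, IsIntegral ℤ ((D : L) * (S.1 : Matrix (Fin n) (Fin n) L) i j)) → d S ≤ D :=
    fun S D hD hint => Nat.find_min' (exists_den L (S : Matrix (Fin n) (Fin n) L)) ⟨hD, hint⟩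
  have hd1 : ∀ S, 1 ≤ d S := fun S => (hd_spec S).1
  -- the lattice `M_n(𝓞_L) ⊂ M_n(L ⊗ ℝ)` and the rank exponent `k`
  let Bs := Pi.basis fun _ : Fin n => Pi.basis fun _ : Fin n => latticeBasis L
  let Λ₀ : Submodule ℤ (Fin n → Fin n → mixedSpace L) := Submodule.span ℤ (Set.range Bs)
  let mixed : skewMatrices ((IsCMField.complexConj L : L ≃ₐ[Fp L] L) : L →+* L) ((gramR L e dV hdV dW hdW).map (algebraMap (Fp L) L)) →
      (Fin n → Fin n → mixedSpace L) := fun S i j => mixedEmbedding L ((S : Matrix (Fin n) (Fin n) L) i j)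
  have hmixed_inj : Function.Injective mixed := by
    intro S S' hSS'
    apply Subtype.ext
    ext i j
    exact mixedEmbedding_injective L (congrFun (congrFun hSS' i) j)
  set k : ℕ := Module.finrank ℤ Λ₀ + 1 with hk
  -- (L-cnt): the fibre `{d = D}` injects into `Λ₀` by `S ↦ D • σ(S)` with norms `≤ D·τ(S)`
  have hcnt : ∀ D : ℕ, 1 ≤ D →
      Summable (fun i : {S // d S = D} => ((1 + τ i.1) ^ k)⁻¹) ∧
        ∑' i : {S // d S = D}, ((1 + τ i.1) ^ k)⁻¹ ≤ (∑' z : Λ₀, ((1 + ‖z‖) ^ k)⁻¹) * (D : ℝ) ^ k := by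
    intro D hD
    have hDr : (1 : ℝ) ≤ D := by exact_mod_cast hD
    have hmem : ∀ i : {S // d S = D}, (D : ℝ) • mixed i.1 ∈ Λ₀ := by
      intro i
      have hint := (hd_spec i.1).2
      rw [i.2] at hint
      have : (D : ℝ) • mixed i.1 = fun a b => mixedEmbedding L ((D : L) * (i.1 : Matrix (Fin n) (Fin n) L) a b) := by
        funext a b
        exact natCast_smul_mixedEmbedding L D _
      rw [this]
      exact mixed_mem_span L (S := fun a b => (D : L) * (i.1 : Matrix (Fin n) (Fin n) L) a b) hint
    let φ : {S // d S = D} → Λ₀ := fun i => ⟨(D : ℝ) • mixed i.1, hmem i⟩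
    have hφ : Function.Injective φ := by
      intro i i' hii'
      have h1 : (D : ℝ) • mixed i.1 = (D : ℝ) • mixed i'.1 := congrArg Subtype.val hii'
      exact Subtype.ext (hmixed_inj (smul_right_injective _ (Nat.cast_ne_zero.2 (Nat.one_le_iff_ne_zero.1 hD)) h1))
    have hφτ : ∀ i, ‖φ i‖ ≤ (D : ℝ) * τ i.1 := by
      intro i
      change ‖(D : ℝ) • mixed i.1‖ ≤ _
      rw [_root_.norm_smul, Real.norm_natCast]
      exact mul_le_mul_of_nonneg_left (hτ i.1) (by positivity)
    exact latticeFibreCount Λ₀ (Nat.lt_succ_self _) φ hφ hDr (fun i => τ i.1) (fun i => hτ0 i.1) hφτ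
  -- the weight
  refine ⟨fun S => ((1 + τ S) ^ k)⁻¹ * ((d S : ℝ) ^ (k + 2))⁻¹, fun S => weight_nonneg τ hτ0 d k (k + 2) S,
    summable_weight_of_latticeCount τ hτ0 d hd1 k (tsum_one_add_norm_pow_inv_nonneg Λ₀ k) le_rfl hcnt, ?_⟩
  -- the growth: ★ p861906 applied to the `{0 < re s}`-truncated product
  let E : skewMatrices ((IsCMField.complexConj L : L ≃ₐ[Fp L] L) : L →+* L) ((gramR L e dV hdV dW hdW).map (algebraMap (Fp L) L)) → ℂ → HA L e dV hdV dW hdW → ℂ :=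
    fun S s h => if 0 < s.re then WT S s h * GW S s h else 0
  have hdec' : ∀ z : ℂ, 0 < z.re → ∃ C A c A' r : ℝ, 0 ≤ C ∧ 0 ≤ A ∧ 0 < c ∧ 0 ≤ A' ∧ 0 < r ∧ ∀ S (s : ℂ), dist s z < r → ∀ h : HA L e dV hdV dW hdW,
      ‖E S s h‖ ≤ C * adelicHeightGL (n + n) L (h : GL (Fin (n + n)) (AdeleRing (𝓞 L) L)) ^ A * (Real.exp (-(c * adelicHeightGL (n + n) L (h : GL (Fin (n + n)) (AdeleRing (𝓞 L) L)) ^ (-A') * τ S)) * (1 + τ S) ^ N₀) := by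
    intro z hz
    obtain ⟨C, A, c, A', r, hC, hA, hc, hA', hr, hle⟩ := hdec z hz
    obtain ⟨C₂, A₂, r₂, hC₂, hA₂, hr₂, hle₂⟩ := hbdd z hz
    refine ⟨C * C₂, A + A₂, c, A', min r r₂, mul_nonneg hC hC₂, add_nonneg hA hA₂, hc, hA', lt_min hr hr₂, fun S s hs h => ?_⟩
    have hH := hHpos h
    have hτS := hτ0 S
    by_cases hsre : 0 < s.re
    · have h1 := hle S s (lt_of_lt_of_le hs (min_le_left _ _)) h
      have h2 := hle₂ S s (lt_of_lt_of_le hs (min_le_right _ _)) h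
      simp only [E, if_pos hsre, norm_mul]
      calc ‖WT S s h‖ * ‖GW S s h‖
          ≤ (C * adelicHeightGL (n + n) L (h : GL (Fin (n + n)) (AdeleRing (𝓞 L) L)) ^ A * (Real.exp (-(c * adelicHeightGL (n + n) L (h : GL (Fin (n + n)) (AdeleRing (𝓞 L) L)) ^ (-A') * τ S)) * (1 + τ S) ^ N₀)) * (C₂ * adelicHeightGL (n + n) L (h : GL (Fin (n + n)) (AdeleRing (𝓞 L) L)) ^ A₂) :=
            mul_le_mul h1 h2 (norm_nonneg _) (by positivity)
        _ = C * C₂ * adelicHeightGL (n + n) L (h : GL (Fin (n + n)) (AdeleRing (𝓞 L) L)) ^ (A + A₂) * (Real.exp (-(c * adelicHeightGL (n + n) L (h : GL (Fin (n + n)) (AdeleRing (𝓞 L) L)) ^ (-A') * τ S)) * (1 + τ S) ^ N₀) := by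
            rw [Real.rpow_add hH]; ring
    · simp only [E, if_neg hsre, norm_zero]
      positivity
  have hsupp' : ∀ S (s : ℂ) (h : HA L e dV hdV dW hdW), E S s h ≠ 0 → (d S : ℝ) ≤ C₀ * adelicHeightGL (n + n) L (h : GL (Fin (n + n)) (AdeleRing (𝓞 L) L)) ^ κ := by
    intro S s h hne
    by_cases hsre : 0 < s.re
    · simp only [E, if_pos hsre] at hne
      obtain ⟨D, hD1, hDle, hint⟩ := hsupp S s h hsre hne
      exact le_trans (by exact_mod_cast hd_min S D hD1 hint) hDle
    · exact absurd (by simp only [E, if_neg hsre]) hne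
  have hmain := weightedGrowth_of_decay_and_support (fun h : HA L e dV hdV dW hdW => adelicHeightGL (n + n) L (h : GL (Fin (n + n)) (AdeleRing (𝓞 L) L))) hm hfloor E τ hτ0 d hd1 N₀ hdec' hC₀ hκ hsupp' k (k + 2)
  intro z hz
  obtain ⟨C, A, r, hC, hA, hr, hle⟩ := hmain z hz
  refine ⟨C, A, min r z.re, hC, hA, lt_min hr hz, fun S s hs h => ?_⟩
  have hsre : 0 < s.re := by
    have h1 : |(s - z).re| ≤ ‖s - z‖ := Complex.abs_re_le_norm (s - z)
    rw [Complex.sub_re, ← dist_eq_norm] at h1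
    have h2 := lt_of_lt_of_le hs (min_le_right _ _)
    have h3 := (abs_le.1 h1).1
    linarith
  have := hle S s (lt_of_lt_of_le hs (min_le_left _ _)) h
  simpa only [E, if_pos hsre] using this

end Generic

/-! ## §4 At F0P2-p08 (g0)'s bytes: `WT := A`, `GW S s h := (b^{U S h}(s))⁻¹` -/

section FactorLetters

open Literature.NumberTheory.GelbartRogawski1991 Literature.NumberTheory.GelbartRogawski1991.GRConstruction
open Literature.NumberTheory.GaloisRepresentations Literature.NumberTheory.LFunctions
open Literature.NumberTheory.K2Lit.SiegelDoubled
open K2LiuSiegelUnipotentFourierDefs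
open K2LiuGoodPlaceWhittakerProductBound (norm_inv_b_le_uniform_cm)

variable (L : Type) [Field L] [NumberField L] [IsCMField L] {N M n : ℕ} (hn : 0 < n) (e : Fin N × Fin M ≃ Fin n)
  (dV : Fin N → L) (hdV : ∀ i, IsCMField.complexConj L (dV i) = dV i)
  (dW : Fin M → L) (hdW : ∀ i, IsCMField.complexConj L (dW i) = dW i)

include hn in
/-- **THE TOP's `(w, hw0, hws, hg)` AT THE FACTOR LETTERS** of `K2LiuSiegelEisensteinWhittakerFactorLetters.exists_whittaker_factorLetters` (`WT := A`, `GW S s h := (b^{U S h}(s))⁻¹`,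
`b^U(s) = ζ^U_{L⁺}(2s+1)·L^U(2s+2, ε_{L∕L⁺})`).  LETTERS BY VALUE on `A` alone: the size comparison `hτ`, (L-dec) archimedean Gaussian decay in height form, (L-supp) bounded-denominator
support on `{0 < re s}`; `‖(b^U(s))⁻¹‖ ≤ C(σ₀)` uniformly in `U` is ★ `norm_inv_b_le_uniform_cm` BY NAME.  OUTPUT: the conjuncts `hw0 ∧ hws ∧ hg` of the consumer's head VERBATIM.
[cite: MoeglinWaldspurger1995, II.1.7, IV.1.9] [cite: Shimura1997, §18.4, Prop. 18.14] [cite: KudlaRallis1994, §1–§2] [cite: NeukirchANT1999, Ch. VII §8] -/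
theorem exists_whittaker_factorLetters_weight
    (A : skewMatrices ((IsCMField.complexConj L : L ≃ₐ[Fp L] L) : L →+* L) ((gramR L e dV hdV dW hdW).map (algebraMap (Fp L) L)) → ℂ → HA L e dV hdV dW hdW → ℂ)
    (U : skewMatrices ((IsCMField.complexConj L : L ≃ₐ[Fp L] L) : L →+* L) ((gramR L e dV hdV dW hdW).map (algebraMap (Fp L) L)) → HA L e dV hdV dW hdW →
      Set (HeightOneSpectrum (𝓞 ↥(maximalRealSubfield L))))
    (τ : skewMatrices ((IsCMField.complexConj L : L ≃ₐ[Fp L] L) : L →+* L) ((gramR L e dV hdV dW hdW).map (algebraMap (Fp L) L)) → ℝ)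
    (hτ : ∀ S : skewMatrices ((IsCMField.complexConj L : L ≃ₐ[Fp L] L) : L →+* L) ((gramR L e dV hdV dW hdW).map (algebraMap (Fp L) L)),
      ‖(fun i j => mixedEmbedding L ((S : Matrix (Fin n) (Fin n) L) i j))‖ ≤ τ S) (N₀ : ℕ)
    (hdec : ∀ z : ℂ, 0 < z.re → ∃ C a c a' r : ℝ, 0 ≤ C ∧ 0 ≤ a ∧ 0 < c ∧ 0 ≤ a' ∧ 0 < r ∧ ∀ S (s : ℂ), dist s z < r → ∀ h : HA L e dV hdV dW hdW,
      ‖A S s h‖ ≤ C * adelicHeightGL (n + n) L (h : GL (Fin (n + n)) (AdeleRing (𝓞 L) L)) ^ a *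
        (Real.exp (-(c * adelicHeightGL (n + n) L (h : GL (Fin (n + n)) (AdeleRing (𝓞 L) L)) ^ (-a') * τ S)) * (1 + τ S) ^ N₀))
    {C₀ κ : ℝ} (hC₀ : 0 < C₀) (hκ : 0 ≤ κ)
    (hsupp : ∀ S (s : ℂ) (h : HA L e dV hdV dW hdW), 0 < s.re → A S s h ≠ 0 →
      ∃ D : ℕ, 1 ≤ D ∧ (D : ℝ) ≤ C₀ * adelicHeightGL (n + n) L (h : GL (Fin (n + n)) (AdeleRing (𝓞 L) L)) ^ κ ∧
        ∀ i j, IsIntegral ℤ ((D : L) * (S : Matrix (Fin n) (Fin n) L) i j)) :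
    ∃ w : skewMatrices ((IsCMField.complexConj L : L ≃ₐ[Fp L] L) : L →+* L) ((gramR L e dV hdV dW hdW).map (algebraMap (Fp L) L)) → ℝ,
        (∀ S, 0 ≤ w S) ∧
        (Summable w) ∧
        (∀ z : ℂ, 0 < z.re → ∃ C A' r : ℝ, 0 ≤ C ∧ 0 ≤ A' ∧ 0 < r ∧ ∀ S (s : ℂ), dist s z < r → ∀ h : HA L e dV hdV dW hdW,
      ‖A S s h * (partialStandardL (U S h) (fun _ => {1}) (2 * s + 1) *
          partialStandardL (U S h) (fun v => {(quadraticHeckeCharCM L).valueAtUniformizer v}) (2 * s + 2))⁻¹‖ ≤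
        C * w S * adelicHeightGL (n + n) L (h : GL (Fin (n + n)) (AdeleRing (𝓞 L) L)) ^ A') := by
  -- `‖(b^U(s))⁻¹‖ ≤ C(re z ∕ 2)` on the ball of radius `re z ∕ 2` about `z`, uniformly in `U` and `h`
  have hbdd : ∀ z : ℂ, 0 < z.re → ∃ C A r : ℝ, 0 ≤ C ∧ 0 ≤ A ∧ 0 < r ∧ ∀ S (s : ℂ), dist s z < r → ∀ h : HA L e dV hdV dW hdW,
      ‖(partialStandardL (U S h) (fun _ => ({1} : Multiset ℂ)) (2 * s + 1) *
          partialStandardL (U S h) (fun v => {(quadraticHeckeCharCM L).valueAtUniformizer v}) (2 * s + 2))⁻¹‖ ≤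
        C * adelicHeightGL (n + n) L (h : GL (Fin (n + n)) (AdeleRing (𝓞 L) L)) ^ A := by
    intro z hz
    obtain ⟨C, hC, hb⟩ := norm_inv_b_le_uniform_cm L (σ₀ := z.re / 2) (by linarith)
    refine ⟨C, 0, z.re / 2, hC.le, le_rfl, by linarith, fun S s hs h => ?_⟩
    rw [Real.rpow_zero, mul_one]
    refine hb (U S h) s ?_
    have h1 : |(s - z).re| ≤ ‖s - z‖ := Complex.abs_re_le_norm (s - z)
    rw [Complex.sub_re, ← dist_eq_norm] at h1
    have h3 := (abs_le.1 h1).1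
    linarith
  exact exists_whittaker_weight L hn e dV hdV dW hdW A
    (fun S s h => (partialStandardL (U S h) (fun _ => ({1} : Multiset ℂ)) (2 * s + 1) *
      partialStandardL (U S h) (fun v => {(quadraticHeckeCharCM L).valueAtUniformizer v}) (2 * s + 2))⁻¹)
    τ hτ N₀ hdec hbdd hC₀ hκ (fun S s h hs hne => hsupp S s h hs (left_ne_zero_of_mul hne))

end FactorLetters

end Summit.HodgeConjecture.HodgeConjecture.Cruxes.HLiu418.K2LiuWhittakerWeightedGrowthInstance

end
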